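import Mathlib.Algebra.Order.BigOperators.Group.Finset
import Mathlib.Algebra.BigOperators.Ring.Finset
import Mathlib.Data.Real.Basic
import Mathlib.Data.Finset.Powerset
import Mathlib.Tactic.Linarith
import Mathlib.Tactic.Ring
import HarnessLib

/-!
# The atom split of a no-core sum: `NC = A₀₀ + 2·A₀B` — prim-lf-2 gen 60

Support file (`--supports stmt-CriticalPhenomena-4575`, closed), prover `prim-lf-2` (gen 60).  No definitions, no named facts, no sorries; standard axioms.
Memo `prim-lf-2/CW-ATOM-gen60.md` §9 (the ATOM TABLE and CONJECTURE NC-SPLIT); companion `…RootSetKernelSplit.lean` (the admissible/inadmissible split of RCSET).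

A NO-CORE SUM.  For a finset of edges `E`, a map `K : Finset ι → Set V` (red cluster of the root as a function of the red edge set `s`; the blue cluster is `K (E ∖ s)`),
a target `y`, and `T(X,Y) = (fX − fY)(gX − gY)`:  `NC = Σ_{s ⊆ E : ¬(y ∈ K s ∧ y ∈ K(E∖s))} T(K s, K(E ∖ s))`.  Split the admissible colourings by the position of `y`:
`00 = {y ∉ K s, y ∉ K(E∖s)}`, `0B = {y ∉ K s, y ∈ K(E∖s)}`, `K0 = {y ∈ K s, y ∉ K(E∖s)}`; the colour swap `s ↦ E ∖ s` exchanges `0B` and `K0` and preserves `T`.  Hence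
* `Coefficientwise.noCore_atom_split` — the IDENTITY `NC = A₀₀ + 2·A₀B` with `A₀₀ = Σ_{00} T`, `A₀B = Σ_{0B} T`;
* `Coefficientwise.noCore_nonneg_of_atoms` — `0 ≤ A₀₀ → 0 ≤ A₀B → 0 ≤ NC`.
CONJECTURE NC-SPLIT (prim-lf-2 gen 60): for the clusters of a vertex `x` in a finite multigraph and monotone `f, g`, BOTH `A₀₀ ≥ 0` and `A₀B ≥ 0` (exact census over all monotone pairs:
every connected graph on ≤ 5 vertices, every `(x, y)`: 0 failures; the pieces `{K0}` alone and `{y ∉ K(E∖s)}` are NOT of constant sign for general nested root sets).  `A₀B ≥ 0` is the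
point case of the principal-event off-cluster conjecture PEOC (memo §8), `A₀₀ ≥ 0` its non-connection twin; together they would give CONJECTURE NO-CORE.
[cite: KozmaNitzan2024, Questions 8–9 (§5.5 p. 36) (context: the Question-8 pocket covariance programme)]
-/

namespace Summit.CriticalPhenomena.PercolationContinuityZ3.Theorems

open Finset

namespace Coefficientwise

variable {ι V : Type*}

open Classical in
/-- **Atom split of a no-core sum (identity).**  For `K : Finset ι → Set V`, a finset `E`, a target `y` and real `f, g`:
`Σ_{s ⊆ E, ¬(y∈K s ∧ y∈K(E∖s))} T(K s, K(E∖s)) = Σ_{s ⊆ E, y∉K s, y∉K(E∖s)} T + 2·Σ_{s ⊆ E, y∉K s, y∈K(E∖s)} T` with `T(X,Y) = (fX − fY)(gX − gY)`. [folklore] -/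
theorem noCore_atom_split [DecidableEq ι] (E : Finset ι) (K : Finset ι → Set V) (y : V) (f g : Set V → ℝ) :
    ∑ s ∈ E.powerset.filter (fun s => ¬ (y ∈ K s ∧ y ∈ K (E \ s))), (f (K s) - f (K (E \ s))) * (g (K s) - g (K (E \ s))) =
      (∑ s ∈ E.powerset.filter (fun s => y ∉ K s ∧ y ∉ K (E \ s)), (f (K s) - f (K (E \ s))) * (g (K s) - g (K (E \ s)))) +
        2 * ∑ s ∈ E.powerset.filter (fun s => y ∉ K s ∧ y ∈ K (E \ s)), (f (K s) - f (K (E \ s))) * (g (K s) - g (K (E \ s))) := by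
  set T : Finset ι → ℝ := fun s => (f (K s) - f (K (E \ s))) * (g (K s) - g (K (E \ s))) with hT
  change ∑ s ∈ E.powerset.filter (fun s => ¬ (y ∈ K s ∧ y ∈ K (E \ s))), T s =
    (∑ s ∈ E.powerset.filter (fun s => y ∉ K s ∧ y ∉ K (E \ s)), T s) + 2 * ∑ s ∈ E.powerset.filter (fun s => y ∉ K s ∧ y ∈ K (E \ s)), T s
  -- split the admissible colourings by `y ∈ K s`
  have h1 : ∑ s ∈ E.powerset.filter (fun s => ¬ (y ∈ K s ∧ y ∈ K (E \ s))), T s =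
      ∑ s ∈ E.powerset.filter (fun s => y ∉ K s), T s + ∑ s ∈ E.powerset.filter (fun s => y ∈ K s ∧ y ∉ K (E \ s)), T s := by
    rw [← Finset.sum_filter_add_sum_filter_not (E.powerset.filter (fun s => ¬ (y ∈ K s ∧ y ∈ K (E \ s)))) (fun s => y ∉ K s)]
    congr 1
    · congr 1; ext s; simp only [Finset.mem_filter]; tauto
    · congr 1; ext s; simp only [Finset.mem_filter, not_not]; tauto
  -- split `{y ∉ K s}` by `y ∈ K (E \ s)`
  have h2 : ∑ s ∈ E.powerset.filter (fun s => y ∉ K s), T s =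
      ∑ s ∈ E.powerset.filter (fun s => y ∉ K s ∧ y ∉ K (E \ s)), T s + ∑ s ∈ E.powerset.filter (fun s => y ∉ K s ∧ y ∈ K (E \ s)), T s := by
    rw [← Finset.sum_filter_add_sum_filter_not (E.powerset.filter (fun s => y ∉ K s)) (fun s => y ∉ K (E \ s))]
    congr 1
    · congr 1; ext s; simp only [Finset.mem_filter]; tauto
    · congr 1; ext s; simp only [Finset.mem_filter, not_not]; tauto
  -- the colour swap maps `K0` onto `0B`
  have h3 : ∑ s ∈ E.powerset.filter (fun s => y ∈ K s ∧ y ∉ K (E \ s)), T s = ∑ s ∈ E.powerset.filter (fun s => y ∉ K s ∧ y ∈ K (E \ s)), T s := by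
    have hss : ∀ s ∈ E.powerset, E \ (E \ s) = s := fun s hs => Finset.sdiff_sdiff_eq_self (Finset.mem_powerset.mp hs)
    refine Finset.sum_bij' (fun s _ => E \ s) (fun s _ => E \ s) ?_ ?_ ?_ ?_ ?_
    · intro s hs
      obtain ⟨hsE, h1', h2'⟩ := by simpa only [Finset.mem_filter] using hs
      refine Finset.mem_filter.mpr ⟨Finset.mem_powerset.mpr Finset.sdiff_subset, h2', ?_⟩
      rw [hss s hsE]; exact h1'
    · intro s hs
      obtain ⟨hsE, h1', h2'⟩ := by simpa only [Finset.mem_filter] using hs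
      refine Finset.mem_filter.mpr ⟨Finset.mem_powerset.mpr Finset.sdiff_subset, h2', ?_⟩
      rw [hss s hsE]; exact h1'
    · intro s hs; exact hss s (Finset.mem_filter.mp hs).1
    · intro s hs; exact hss s (Finset.mem_filter.mp hs).1
    · intro s hs
      have hsE := (Finset.mem_filter.mp hs).1
      simp only [hT, hss s hsE]; ring
  rw [h1, h2, h3]; ring

open Classical in
/-- **NO-CORE from the two atoms.**  With the notation of `noCore_atom_split`: if `A₀₀ = Σ_{y∉K s, y∉K(E∖s)} T ≥ 0` and `A₀B = Σ_{y∉K s, y∈K(E∖s)} T ≥ 0` then the no-core sum is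
`≥ 0`. [folklore] -/
theorem noCore_nonneg_of_atoms [DecidableEq ι] (E : Finset ι) (K : Finset ι → Set V) (y : V) (f g : Set V → ℝ)
    (h00 : 0 ≤ ∑ s ∈ E.powerset.filter (fun s => y ∉ K s ∧ y ∉ K (E \ s)), (f (K s) - f (K (E \ s))) * (g (K s) - g (K (E \ s))))
    (h0B : 0 ≤ ∑ s ∈ E.powerset.filter (fun s => y ∉ K s ∧ y ∈ K (E \ s)), (f (K s) - f (K (E \ s))) * (g (K s) - g (K (E \ s)))) :
    0 ≤ ∑ s ∈ E.powerset.filter (fun s => ¬ (y ∈ K s ∧ y ∈ K (E \ s))), (f (K s) - f (K (E \ s))) * (g (K s) - g (K (E \ s))) := by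
  rw [noCore_atom_split E K y f g]; linarith

end Coefficientwise

end Summit.CriticalPhenomena.PercolationContinuityZ3.Theorems
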